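import Mathlib
import Literature.NumberTheory.Sieve.PolynomialCongruencesRootCount
import Literature.NumberTheory.LFunctions.MertensTail
import Summits.Parity.BatemanHorn.Theorems.SoloBlindSmoothPart
import Summits.Parity.BatemanHorn.Theorems.SoloBlindNagellLocal

/-!
# Chebyshev–Markov–Nagell for every irreducible polynomial, II: the smooth part

Solo seat `solo-Parity-blind` (summit `Parity`, conjunct `BatemanHorn`), session 9.  Part II of
three; see `SoloBlindNagell.lean` for the theorem.

This part sums the local counts of Part I over the primes `p ≤ x` with weight `log p`:
`∑_{p ≤ x} log p ∑_{k ≤ x} v_p(|f(k)|) ≤ x ∑_{p ≤ x} ρ_f(p) log p / p + B θ(x) + 2 B x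
+ B π(x) log (H x^d)`, using `∑_p log p/(p(p−1)) ≤ 2`
(`Literature.NumberTheory.LFunctions.MertensBound.sum_log_div_mul_pred_le_two`) and Chebyshev's
`π(x) log x ≤ (2 log 4 + 2) x` (Mathlib's `Chebyshev.pi_le_log4_mul_div`).
No `sorry`, standard axioms only.
-/

open Finset Real Polynomial

namespace Summit.Parity.BatemanHorn.Theorems.SoloBlindNagellSmooth

open Literature.NumberTheory.Sieve
open Summit.Parity.BatemanHorn.Theorems.SoloBlindSmoothPart
open Summit.Parity.BatemanHorn.Theorems.SoloBlindNagellLocal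

/-! ### Summing over the primes `p ≤ x`: the smooth part is `x log x + O(x)` -/

/-- `A log p ≤ log N` for `A = ⌊log_p N⌋`, and the indicator forces `p ≤` itself only through `p²≤N`;
we just bound the indicator term by `log N`. -/
theorem indicator_mul_log_le {N p : ℕ} (hp : p.Prime) (hN : 1 ≤ N) :
    (if p ^ 2 ≤ N then (Nat.log p N : ℝ) else 0) * Real.log p ≤ Real.log N := by
  have hlogN : 0 ≤ Real.log N := Real.log_nonneg (by exact_mod_cast hN)
  split_ifs with h1
  · rw [← Real.log_pow, ← Nat.cast_pow]
    apply Real.log_le_log (by exact_mod_cast pow_pos hp.pos _)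
    exact_mod_cast Nat.pow_log_le_self p (by omega : N ≠ 0)
  · simpa using hlogN

/-- Chebyshev: `π(x) log x ≤ (2 log 4 + 2) x` for `x ≥ 2`. -/
theorem card_primesLE_mul_log_le' {x : ℕ} (hx : 2 ≤ x) :
    ((Nat.primesLE x).card : ℝ) * Real.log x ≤ (2 * Real.log 4 + 2) * x := by
  have hx1 : (1 : ℝ) < x := by exact_mod_cast hx
  have hx0 : (0 : ℝ) < x := by linarith
  have hpi := Chebyshev.pi_le_log4_mul_div hx1
  rw [Nat.floor_natCast, ← Nat.primesLE_card_eq_primeCounting] at hpi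
  have hsqrt : Real.log (Real.sqrt x) = Real.log x / 2 := Real.log_sqrt hx0.le
  rw [hsqrt] at hpi
  have hlogx : 0 < Real.log x := Real.log_pos hx1
  have hsl : Real.sqrt x * Real.log x ≤ 2 * x := by
    have hs0 : 0 < Real.sqrt x := Real.sqrt_pos.mpr hx0
    have h1 : Real.log (Real.sqrt x) ≤ Real.sqrt x - 1 := Real.log_le_sub_one_of_pos hs0
    have h2 : Real.log x = 2 * Real.log (Real.sqrt x) := by rw [hsqrt]; ring
    have h3 : Real.sqrt x * Real.sqrt x = x := Real.mul_self_sqrt hx0.le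
    nlinarith
  have : ((Nat.primesLE x).card : ℝ) ≤ Real.log 4 * x / (Real.log x / 2) + Real.sqrt x := hpi
  have hne : Real.log x ≠ 0 := ne_of_gt hlogx
  have e : Real.log 4 * x / (Real.log x / 2) * Real.log x = 2 * Real.log 4 * x := by
    field_simp
  have hmul := mul_le_mul_of_nonneg_right this hlogx.le
  rw [add_mul, e] at hmul
  linarith

/-- **The smooth part**: with `ρ_f(p^a) ≤ B`,
`∑_{p ≤ x} log p ∑_{k ≤ x} v_p(|f(k)|) ≤ x ∑_{p ≤ x} ρ_f(p) log p / p + B θ(x) + 2 B x + B π(x) log (H x^d)`. -/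
theorem smooth_part_le {f : ℤ[X]} (hirr : Irreducible f) (hdeg : 2 ≤ f.natDegree)
    {B : ℕ} (hB : ∀ p : ℕ, p.Prime → ∀ a : ℕ, polyRootCountMod ![f] (p ^ a) ≤ B) (x : ℕ) :
    ∑ p ∈ Nat.primesLE x, Real.log p * ∑ k ∈ Icc 1 x, ((absVal f k).factorization p : ℝ)
      ≤ (x : ℝ) * (∑ p ∈ Nat.primesLE x, (polyRootCountMod ![f] p : ℝ) * Real.log p / p)
        + B * Chebyshev.theta (x : ℝ) + 2 * B * x
        + B * ((Nat.primesLE x).card : ℝ) * Real.log ((height f * x ^ f.natDegree : ℕ) : ℝ) := by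
  set N := height f * x ^ f.natDegree with hNdef
  have hterm : ∀ p ∈ Nat.primesLE x,
      Real.log p * ∑ k ∈ Icc 1 x, ((absVal f k).factorization p : ℝ)
        ≤ (x : ℝ) * ((polyRootCountMod ![f] p : ℝ) * Real.log p / p) + B * Real.log p
          + B * x * (Real.log p / ((p : ℝ) * (p - 1)))
          + B * Real.log N := by
    intro p hp
    rw [Nat.mem_primesLE] at hp
    have hlog : 0 ≤ Real.log p := Real.log_nonneg (by exact_mod_cast hp.2.one_lt.le)
    have h := sum_factorization_absVal_le hirr hdeg hB x hp.2
    have hp0 : (0 : ℝ) < p := by exact_mod_cast hp.2.pos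
    have hB0 : (0 : ℝ) ≤ B := by positivity
    have hmul := mul_le_mul_of_nonneg_left h hlog
    rcases Nat.eq_zero_or_pos N with hN0 | hNpos
    · -- degenerate: `N = 0` forces `x = 0`, all sums vanish
      have hx0 : x = 0 := by
        rcases Nat.eq_zero_or_pos x with h0 | hxpos
        · exact h0
        · exfalso
          have h1 : 1 ≤ height f := one_le_height hirr.ne_zero
          have : 0 < height f * x ^ f.natDegree := Nat.mul_pos (by omega) (pow_pos hxpos _)
          omega
      subst hx0
      simp only [Nat.cast_zero, zero_mul, mul_zero, zero_add, add_zero,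
        show Icc 1 0 = (∅ : Finset ℕ) by decide, Finset.sum_empty]
      have : 0 ≤ (B : ℝ) * Real.log N := mul_nonneg hB0 (by
        rw [hN0]; simp)
      nlinarith
    have hi := indicator_mul_log_le (N := N) hp.2 hNpos
    have hind0 : (0 : ℝ) ≤ (if p ^ 2 ≤ N then (Nat.log p N : ℝ) else 0) := by
      split_ifs <;> positivity
    have e1 : Real.log p * ((polyRootCountMod ![f] p : ℝ) * x / p + B + B * x / ((p : ℝ) * (p - 1))
        + B * (if p ^ 2 ≤ N then (Nat.log p N : ℝ) else 0))
        = (x : ℝ) * ((polyRootCountMod ![f] p : ℝ) * Real.log p / p) + B * Real.log p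
          + B * x * (Real.log p / ((p : ℝ) * (p - 1)))
          + B * ((if p ^ 2 ≤ N then (Nat.log p N : ℝ) else 0) * Real.log p) := by
      ring
    rw [e1] at hmul
    have e2 : (B : ℝ) * ((if p ^ 2 ≤ N then (Nat.log p N : ℝ) else 0) * Real.log p)
        ≤ B * Real.log N := mul_le_mul_of_nonneg_left hi hB0
    linarith
  calc ∑ p ∈ Nat.primesLE x, Real.log p * ∑ k ∈ Icc 1 x, ((absVal f k).factorization p : ℝ)
      ≤ ∑ p ∈ Nat.primesLE x, ((x : ℝ) * ((polyRootCountMod ![f] p : ℝ) * Real.log p / p)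
          + B * Real.log p + B * x * (Real.log p / ((p : ℝ) * (p - 1))) + B * Real.log N) :=
        Finset.sum_le_sum hterm
    _ = (x : ℝ) * (∑ p ∈ Nat.primesLE x, (polyRootCountMod ![f] p : ℝ) * Real.log p / p)
          + B * Chebyshev.theta (x : ℝ)
          + B * x * ∑ p ∈ Nat.primesLE x, Real.log p / ((p : ℝ) * (p - 1))
          + B * ((Nat.primesLE x).card : ℝ) * Real.log N := by
        rw [Chebyshev.theta_eq_sum_primesLE_log x,
          Finset.sum_add_distrib, Finset.sum_add_distrib, Finset.sum_add_distrib,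
          Finset.mul_sum, Finset.mul_sum, Finset.mul_sum, Finset.sum_const, nsmul_eq_mul]
        ring
    _ ≤ _ := by
        have hA := Literature.NumberTheory.LFunctions.MertensBound.sum_log_div_mul_pred_le_two x
        have hx0 : (0 : ℝ) ≤ (B : ℝ) * x := by positivity
        nlinarith

/-- `π(x) ≤ x + 1`. -/
theorem card_primesLE_le (x : ℕ) : (Nat.primesLE x).card ≤ x + 1 := by
  have h : (Nat.primesLE x).card ≤ (range (x + 1)).card := by
    apply Finset.card_le_card
    intro p hp
    rw [Nat.mem_primesLE] at hp
    exact mem_range.mpr (by omega)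
  rwa [Finset.card_range] at h

end Summit.Parity.BatemanHorn.Theorems.SoloBlindNagellSmooth
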